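import Mathlib
import Literature.AlgebraicGeometry.Resolution.AugmentationIdeal
import Summits.ResolutionOfSingularities.ResolutionOfSingularities.Theorems.WildQuotientsWildQuotientResolutionJordanFiveMu2CoverDefs
import Summits.ResolutionOfSingularities.ResolutionOfSingularities.Theorems.WildQuotientsWildQuotientResolutionJordanFiveMu2CoverAction
import Summits.ResolutionOfSingularities.ResolutionOfSingularities.Theorems.WildQuotientsWildQuotientResolutionJordanFiveMu2CoverActionExists
import Summits.ResolutionOfSingularities.ResolutionOfSingularities.Theorems.WildQuotientsWildQuotientResolutionJordanFiveMu2CoverIrreducible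
import Summits.ResolutionOfSingularities.ResolutionOfSingularities.Theorems.WildQuotientsWildQuotientResolutionJordanFiveMu2CoverRegular
import Summits.ResolutionOfSingularities.ResolutionOfSingularities.Theorems.WildQuotientsWildQuotientResolutionJordanFiveMu2CoverDescent
import Summits.ResolutionOfSingularities.ResolutionOfSingularities.Theorems.WildQuotientsWildQuotientResolutionJordanFiveMu2CoverKL

/-!
# RUNG V5 (`J₅`), brick B7/HP₂ — (α)+(β): the invariants of the twisted-root cover are regular

Sub-problem `ResolutionOfSingularities`, crux `WildQuotients.WildQuotientResolution`
(stmt-ResolutionOfSingularities-15640), line L1 W4.5c, scaffold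
`JordanFive.jordanFive_hasResolution_of_bricks` (p527978), brick `HP₂` (res-L1-w45c-plan-1 RULING
10:50Z; card `mu2-strata-kl-twice` of res-L1-w45c-idea-2).

On the concrete cover `U₂ = (k[s, Y₀,…,Y₄, pass] ⧸ (Φ))[1/î]` (`Localization.Away`) of the
`μ₂`-vertex chart `W₂`, in characteristic `p ≥ 5`:

* `two_ne_zero_of_five_le`, `three_ne_zero_of_five_le` — `2, 3 ≠ 0` in characteristic `p ≥ 5`;
* `not_coverPhi_dvd_X` — `Φ ∤ X_o` for `o ≠ Y₂`; `X_none_mul_X_notMem_span_coverPhi` — `sY₀ ∉ (Φ)`;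
* `isDomain_away_coverIHat` — `U₂` is a domain;
* **`isRegularRing_fixedPoints_away_coverIHat`** — for every `k`-automorphism `σ_U` of `U₂` with the
  cover laws, **`U₂^{⟨σ_U⟩}` is a regular ring** (K–L at `p`, steps (α)+(β) of HP₂); stated with
  `I = (Φ)`, `ι = î` as equations `hI`, `hι` (instantiate with `rfl`) to keep the laws readable;
* `exists_coverSigma_away`, `exists_coverTau_away` — the cover action `σ_U` (with the laws) and
  the deck involution `τ_U` (`s, Y₁, Y₃ ↦ −s, −Y₁, −Y₃`) exist on `U₂`.
-/

-- single-problem summit: the doubled namespace component `ResolutionOfSingularities` is forced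
set_option linter.dupNamespace false

noncomputable section

open MvPolynomial

namespace Summit.ResolutionOfSingularities.ResolutionOfSingularities.Theorems.WildQuotientResolution.JordanFive

/-! ## Characteristic `p ≥ 5` -/

/-- `2 ≠ 0` in characteristic `p ≥ 5`. [folklore] -/
theorem two_ne_zero_of_five_le (k : Type) [Field k] (p : ℕ) [CharP k p] (hp : p.Prime)
    (hp5 : 5 ≤ p) : (2 : k) ≠ 0 := by
  intro h
  have h' : ((2 : ℕ) : k) = 0 := by exact_mod_cast h
  rw [CharP.cast_eq_zero_iff k p] at h'
  have := Nat.le_of_dvd (by norm_num) h'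
  have := hp.two_le
  omega

/-- `3 ≠ 0` in characteristic `p ≥ 5`. [folklore] -/
theorem three_ne_zero_of_five_le (k : Type) [Field k] (p : ℕ) [CharP k p] (hp : p.Prime)
    (hp5 : 5 ≤ p) : (3 : k) ≠ 0 := by
  intro h
  have h' : ((3 : ℕ) : k) = 0 := by exact_mod_cast h
  rw [CharP.cast_eq_zero_iff k p] at h'
  have := Nat.le_of_dvd (by norm_num) h'
  have := hp.two_le
  omega

section Cover

variable (k : Type) [Field k] (n : ℕ) (a b c d e : Fin n)
  (hab : a ≠ b) (hac : a ≠ c) (had : a ≠ d) (hae : a ≠ e) (hbc : b ≠ c) (hbd : b ≠ d)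
  (hbe : b ≠ e) (hcd : c ≠ d) (hce : c ≠ e) (hde : d ≠ e)

/-! ## `sY₀ ∉ (Φ)` -/

include hab hac hae hbc hbe hcd hce hde in
/-- **`Φ ∤ X_o` for every variable `o ≠ Y₂`** (`2, 3 ≠ 0`): otherwise `Φ` would be associated to
`X_o`, but at the point `Y₂ = 2`, all other coordinates `0`, `X_o = 0` while
`Φ = 2·4·(1−2) = −8 ≠ 0`.
[OURS · L1 W4.5c] -/
theorem not_coverPhi_dvd_X (h2 : (2 : k) ≠ 0) (h3 : (3 : k) ≠ 0) (o : Option (Fin n))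
    (ho : o ≠ some c) :
    ¬ (coverPhi (X none) (X (some a)) (X (some b)) (X (some c)) (X (some d))
      (X (some e) : MvPolynomial (Option (Fin n)) k) ∣ X o) := by
  classical
  intro h
  obtain ⟨u, hu⟩ := (coverPhi_irreducible k n a b c d e hab hac hae hbc hbe hce hde h2
    h3).associated_of_dvd (MvPolynomial.X_prime (R := k) (i := o)).irreducible h
  let f : Option (Fin n) → k := fun o' => if o' = some c then 2 else 0
  have hs : eval f (X none : MvPolynomial (Option (Fin n)) k) = 0 := by
    rw [eval_X]; exact if_neg (Option.some_ne_none c).symm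
  have hX : ∀ i, i ≠ c → eval f (X (some i) : MvPolynomial (Option (Fin n)) k) = 0 := by
    intro i hi; rw [eval_X]; exact if_neg (fun h => hi (Option.some_inj.mp h))
  have hc : eval f (X (some c) : MvPolynomial (Option (Fin n)) k) = 2 := by
    rw [eval_X]; exact if_pos rfl
  have ho' : eval f (X o : MvPolynomial (Option (Fin n)) k) = 0 := by
    rw [eval_X]; exact if_neg ho
  have hΦ : eval f (coverPhi (X none) (X (some a)) (X (some b)) (X (some c)) (X (some d))
      (X (some e) : MvPolynomial (Option (Fin n)) k)) = -8 := by
    rw [map_coverPhi, hs, hX a hac, hX b hbc, hc, hX d hcd.symm, hX e hce.symm, coverPhi_core]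
    ring
  have hu' : IsUnit (eval f (↑u : MvPolynomial (Option (Fin n)) k)) := (Units.isUnit u).map _
  have := congrArg (eval f) hu
  rw [map_mul, hΦ, ho'] at this
  have h8 : (-8 : k) = 0 := hu'.mul_left_eq_zero.mp this
  have : (2 : k) ^ 3 = 0 := by linear_combination (-1 : k) * h8
  exact h2 (pow_eq_zero_iff (by norm_num) |>.mp this)

include hab hac hae hbc hbe hcd hce hde in
/-- **`sY₀ ∉ (Φ)`** (`Φ` is prime and divides neither `s` nor `Y₀`). [OURS · L1 W4.5c] -/
theorem X_none_mul_X_notMem_span_coverPhi (h2 : (2 : k) ≠ 0) (h3 : (3 : k) ≠ 0) :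
    (X none * X (some a) : MvPolynomial (Option (Fin n)) k) ∉ Ideal.span
      {coverPhi (X none) (X (some a)) (X (some b)) (X (some c)) (X (some d))
        (X (some e) : MvPolynomial (Option (Fin n)) k)} := by
  intro h
  rcases (coverPhi_prime k n a b c d e hab hac hae hbc hbe hce hde h2 h3).dvd_or_dvd
    (Ideal.mem_span_singleton.mp h) with h' | h'
  · exact not_coverPhi_dvd_X k n a b c d e hab hac hae hbc hbe hcd hce hde h2 h3 none
      (Option.some_ne_none c).symm h'
  · exact not_coverPhi_dvd_X k n a b c d e hab hac hae hbc hbe hcd hce hde h2 h3 (some a)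
      (fun h => hac (Option.some_inj.mp h)) h'

/-! ## The cover `U₂` is a domain; its invariants are regular -/

include hab hac hae hbc hbe hcd hce hde in
/-- **`U₂ = (k[s,Y,pass] ⧸ (Φ))[1/î]` is a domain** (`2, 3 ≠ 0`). [OURS · L1 W4.5c] -/
theorem isDomain_away_coverIHat (h2 : (2 : k) ≠ 0) (h3 : (3 : k) ≠ 0) :
    IsDomain (Localization.Away (Ideal.Quotient.mk (Ideal.span
      {coverPhi (X none) (X (some a)) (X (some b)) (X (some c)) (X (some d))
        (X (some e) : MvPolynomial (Option (Fin n)) k)})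
      (coverIHat (X none) (X (some a)) (X (some b)) (X (some c)) (X (some d)) (X (some e))))) := by
  haveI := isDomain_quotient_coverPhi k n a b c d e hab hac hae hbc hbe hce hde h2 h3
  exact away_quotient_isDomain k n (Ideal.span {coverPhi (X none) (X (some a)) (X (some b))
    (X (some c)) (X (some d)) (X (some e) : MvPolynomial (Option (Fin n)) k)}) (coverIHat (X none)
    (X (some a)) (X (some b)) (X (some c)) (X (some d)) (X (some e))) _
    (coverIHat_notMem_span_coverPhi k n a b c d e hac hbc hcd hce)

variable (I : Ideal (MvPolynomial (Option (Fin n)) k)) (ι : MvPolynomial (Option (Fin n)) k)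
  (hI : I = Ideal.span {coverPhi (X none) (X (some a)) (X (some b)) (X (some c)) (X (some d))
    (X (some e) : MvPolynomial (Option (Fin n)) k)})
  (hι : ι = coverIHat (X none) (X (some a)) (X (some b)) (X (some c)) (X (some d)) (X (some e)))

include hab hac had hae hbc hbd hbe hcd hce hde hI hι in
/-- **HP₂ (α)+(β): the invariants of the twisted-root cover are regular.**  For the cover
`U₂ = (k[s, Y₀,…,Y₄, pass] ⧸ I)[1/ι]`, `I = (Φ)`, `ι = î`, of the `μ₂`-vertex chart `W₂` of
`Bl_O(𝔸⁵)/J₅` (`p ≥ 5`) and ANY `k`-automorphism `σ_U` of `U₂` with the cover laws `s ↦ s`,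
`Y_j ↦ Y_j + sY_{j−1}` (`j = 1..4`), passengers fixed: `U₂` is a regular domain of finite type,
`σ_U` has order `p` with `I_{σ_U} = (s)`, and `U₂^{⟨σ_U⟩}` is a regular ring
[cite: KiralyLutkebohmert2013, Thm. 2 ⇐]. [OURS · L1 W4.5c] -/
theorem isRegularRing_fixedPoints_away_coverIHat {p : ℕ} [CharP k p] (hp : p.Prime) (hp5 : 5 ≤ p)
    (σU : Localization.Away (Ideal.Quotient.mk I ι) ≃ₐ[k] Localization.Away (Ideal.Quotient.mk I ι))
    (hs : σU (algebraMap _ _ (Ideal.Quotient.mk I (X none))) =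
      algebraMap _ _ (Ideal.Quotient.mk I (X none)))
    (h1 : σU (algebraMap _ _ (Ideal.Quotient.mk I (X (some b)))) =
      algebraMap _ _ (Ideal.Quotient.mk I (X (some b))) +
        algebraMap _ _ (Ideal.Quotient.mk I (X none)) *
          algebraMap _ _ (Ideal.Quotient.mk I (X (some a))))
    (h2 : σU (algebraMap _ _ (Ideal.Quotient.mk I (X (some c)))) =
      algebraMap _ _ (Ideal.Quotient.mk I (X (some c))) +
        algebraMap _ _ (Ideal.Quotient.mk I (X none)) *
          algebraMap _ _ (Ideal.Quotient.mk I (X (some b))))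
    (h3 : σU (algebraMap _ _ (Ideal.Quotient.mk I (X (some d)))) =
      algebraMap _ _ (Ideal.Quotient.mk I (X (some d))) +
        algebraMap _ _ (Ideal.Quotient.mk I (X none)) *
          algebraMap _ _ (Ideal.Quotient.mk I (X (some c))))
    (h4 : σU (algebraMap _ _ (Ideal.Quotient.mk I (X (some e)))) =
      algebraMap _ _ (Ideal.Quotient.mk I (X (some e))) +
        algebraMap _ _ (Ideal.Quotient.mk I (X none)) *
          algebraMap _ _ (Ideal.Quotient.mk I (X (some d))))
    (hσ : ∀ i, i ≠ b → i ≠ c → i ≠ d → i ≠ e →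
      σU (algebraMap _ _ (Ideal.Quotient.mk I (X (some i)))) =
        algebraMap _ _ (Ideal.Quotient.mk I (X (some i)))) :
    IsRegularRing (FixedPoints.subalgebra k (Localization.Away (Ideal.Quotient.mk I ι))
      (Subgroup.zpowers σU)) := by
  have h2k := two_ne_zero_of_five_le k p hp hp5
  have h3k := three_ne_zero_of_five_le k p hp hp5
  haveI : IsDomain (MvPolynomial (Option (Fin n)) k ⧸ I) := by
    rw [hI]; exact isDomain_quotient_coverPhi k n a b c d e hab hac hae hbc hbe hce hde h2k h3k
  have hιI : ι ∉ I := by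
    rw [hI, hι]; exact coverIHat_notMem_span_coverPhi k n a b c d e hac hbc hcd hce
  haveI : IsDomain (Localization.Away (Ideal.Quotient.mk I ι)) :=
    away_quotient_isDomain k n I ι _ hιI
  haveI : IsRegularRing (Localization.Away (Ideal.Quotient.mk I ι)) := by
    subst hI hι
    exact isRegularRing_away_coverIHat k n a b c d e hab hac had hae hbc hbd hbe hcd hce hde h2k
  obtain ⟨σA, hAs, hA1, hA2, hA3, hA4, hAσ⟩ :=
    exists_coverSigma k n a b c d e hab hac had hae hbc hbd hbe hcd hce hde
  have hcomp :=
    cover_laws_comp k n a b c d e I _ σU σA hs h1 h2 h3 h4 hσ hAs hA1 hA2 hA3 hA4 hAσ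
  have hιA : σA ι = ι := by
    rw [hι]; exact cover_apply_coverIHat k n σA a b c d e hab hac had hae hAs hA1 hA2 hA3 hA4 hAσ
  have hιU : σU (algebraMap _ _ (Ideal.Quotient.mk I ι)) =
      algebraMap _ _ (Ideal.Quotient.mk I ι) := by
    rw [cover_apply_algebraMap_mk k n I _ σU σA hcomp, hιA]
  have hιspan : ι ∈ Ideal.span ({X (some a), X (some b), X (some c), X (some d)} :
      Set (MvPolynomial (Option (Fin n)) k)) := by
    rw [hι]; exact coverIHat_mem_span _ _ _ _ _ _
  have hne : algebraMap _ (Localization.Away (Ideal.Quotient.mk I ι))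
      (Ideal.Quotient.mk I (X none)) * algebraMap _ _ (Ideal.Quotient.mk I (X (some a))) ≠ 0 := by
    rw [← map_mul, ← map_mul, Ne, algebraMap_mk_eq_zero_iff k n I ι _ hιI, hI]
    exact X_none_mul_X_notMem_span_coverPhi k n a b c d e hab hac hae hbc hbe hcd hce hde h2k h3k
  exact isRegularRing_fixedPoints_cover k n a b c d e hab hac had hae hbc hbd hbe hcd hce hde I ι _
    hp hp5 σU hs h1 h2 h3 h4 hσ hιU hιspan hne

/-! ## Existence of the cover action and of the deck involution on `U₂` -/

include hab hac had hae hbc hbd hbe hcd hce hde hI hι in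
/-- **The cover action `σ_U` exists on `U₂`** (descent of `exists_coverSigma` through `(Φ)` and
`[1/î]`, both `σ`-invariant). [OURS · L1 W4.5c] -/
theorem exists_coverSigma_away :
    ∃ σU : Localization.Away (Ideal.Quotient.mk I ι) ≃ₐ[k]
      Localization.Away (Ideal.Quotient.mk I ι),
    σU (algebraMap _ _ (Ideal.Quotient.mk I (X none))) =
      algebraMap _ _ (Ideal.Quotient.mk I (X none)) ∧
    σU (algebraMap _ _ (Ideal.Quotient.mk I (X (some b)))) =
      algebraMap _ _ (Ideal.Quotient.mk I (X (some b))) +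
        algebraMap _ _ (Ideal.Quotient.mk I (X none)) *
          algebraMap _ _ (Ideal.Quotient.mk I (X (some a))) ∧
    σU (algebraMap _ _ (Ideal.Quotient.mk I (X (some c)))) =
      algebraMap _ _ (Ideal.Quotient.mk I (X (some c))) +
        algebraMap _ _ (Ideal.Quotient.mk I (X none)) *
          algebraMap _ _ (Ideal.Quotient.mk I (X (some b))) ∧
    σU (algebraMap _ _ (Ideal.Quotient.mk I (X (some d)))) =
      algebraMap _ _ (Ideal.Quotient.mk I (X (some d))) +
        algebraMap _ _ (Ideal.Quotient.mk I (X none)) *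
          algebraMap _ _ (Ideal.Quotient.mk I (X (some c))) ∧
    σU (algebraMap _ _ (Ideal.Quotient.mk I (X (some e)))) =
      algebraMap _ _ (Ideal.Quotient.mk I (X (some e))) +
        algebraMap _ _ (Ideal.Quotient.mk I (X none)) *
          algebraMap _ _ (Ideal.Quotient.mk I (X (some d))) ∧
    ∀ i, i ≠ b → i ≠ c → i ≠ d → i ≠ e →
      σU (algebraMap _ _ (Ideal.Quotient.mk I (X (some i)))) =
        algebraMap _ _ (Ideal.Quotient.mk I (X (some i))) := by
  obtain ⟨σA, hAs, hA1, hA2, hA3, hA4, hAσ⟩ :=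
    exists_coverSigma k n a b c d e hab hac had hae hbc hbd hbe hcd hce hde
  have hΦ := cover_apply_coverPhi k n σA a b c d e hab hac had hae hAs hA1 hA2 hA3 hA4 hAσ
  have hIJ : I = I.map
      (σA : MvPolynomial (Option (Fin n)) k →+* MvPolynomial (Option (Fin n)) k) := by
    rw [hI, Ideal.map_span, Set.image_singleton, RingHom.coe_coe, hΦ]
  have hιA : σA ι = ι := by
    rw [hι]; exact cover_apply_coverIHat k n σA a b c d e hab hac had hae hAs hA1 hA2 hA3 hA4 hAσ
  obtain ⟨σU, hσU⟩ :=
    exists_cover_algEquiv_away k n I ι (Localization.Away (Ideal.Quotient.mk I ι)) σA hIJ hιA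
  refine ⟨σU, ?_, ?_, ?_, ?_, ?_, fun i hib hic hid hie => ?_⟩
  · rw [hσU, hAs]
  · rw [hσU, hA1, map_add, map_mul, map_add, map_mul]
  · rw [hσU, hA2, map_add, map_mul, map_add, map_mul]
  · rw [hσU, hA3, map_add, map_mul, map_add, map_mul]
  · rw [hσU, hA4, map_add, map_mul, map_add, map_mul]
  · rw [hσU, hAσ i hib hic hid hie]

include hab had hbc hcd hbe hde hI hι in
/-- **The deck involution `τ_U` exists on `U₂`**: `s, Y₁, Y₃ ↦ −s, −Y₁, −Y₃`, the other variables
fixed, `τ_U ∘ τ_U = id` (descent of `exists_coverTau`; `Φ` and `î` are `τ`-invariant).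
[OURS · L1 W4.5c] -/
theorem exists_coverTau_away :
    ∃ τU : Localization.Away (Ideal.Quotient.mk I ι) ≃ₐ[k]
      Localization.Away (Ideal.Quotient.mk I ι),
    τU (algebraMap _ _ (Ideal.Quotient.mk I (X none))) =
      -algebraMap _ _ (Ideal.Quotient.mk I (X none)) ∧
    τU (algebraMap _ _ (Ideal.Quotient.mk I (X (some b)))) =
      -algebraMap _ _ (Ideal.Quotient.mk I (X (some b))) ∧
    τU (algebraMap _ _ (Ideal.Quotient.mk I (X (some d)))) =
      -algebraMap _ _ (Ideal.Quotient.mk I (X (some d))) ∧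
    (∀ i, i ≠ b → i ≠ d → τU (algebraMap _ _ (Ideal.Quotient.mk I (X (some i)))) =
      algebraMap _ _ (Ideal.Quotient.mk I (X (some i)))) ∧
    ∀ y, τU (τU y) = y := by
  obtain ⟨τA, hτs, hτb, hτd, hτi, hττ⟩ := exists_coverTau k n b d
  have hΦ := coverTau_apply_coverPhi k n a b c d e hab had τA hτs hτb hτd hτi hbc hcd hbe hde
  have hIJ : I = I.map
      (τA : MvPolynomial (Option (Fin n)) k →+* MvPolynomial (Option (Fin n)) k) := by
    rw [hI, Ideal.map_span, Set.image_singleton, RingHom.coe_coe, hΦ]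
  have hιA : τA ι = ι := by
    rw [hι]; exact coverTau_apply_coverIHat k n a b c d e hab had τA hτs hτb hτd hτi hbc hcd hbe hde
  obtain ⟨τU, hτU⟩ :=
    exists_cover_algEquiv_away k n I ι (Localization.Away (Ideal.Quotient.mk I ι)) τA hIJ hιA
  refine ⟨τU, ?_, ?_, ?_, fun i hib hid => ?_, fun y => ?_⟩
  · rw [hτU, hτs, map_neg, map_neg]
  · rw [hτU, hτb, map_neg, map_neg]
  · rw [hτU, hτd, map_neg, map_neg]
  · rw [hτU, hτi i hib hid]
  · have key : (AlgHomClass.toAlgHom (τU * τU) : Localization.Away (Ideal.Quotient.mk I ι) →ₐ[k]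
        Localization.Away (Ideal.Quotient.mk I ι)) = AlgHom.id k _ :=
      away_quotient_algHom_ext k n I ι (Localization.Away (Ideal.Quotient.mk I ι)) (fun o => by
        rw [AlgHom.id_apply]
        change τU (τU (algebraMap _ _ (Ideal.Quotient.mk I (X o)))) = _
        rw [hτU, hτU, hττ])
    exact DFunLike.congr_fun key y

end Cover

end Summit.ResolutionOfSingularities.ResolutionOfSingularities.Theorems.WildQuotientResolution.JordanFive

end
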